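import Summits.QuantumFields.BalabanUV.T4Continuum.Support.RegionTentColumn
import Summits.QuantumFields.BalabanUV.T4Continuum.Support.DirichletStarClassPoincare

/-!
# T⁴ programme, spine node NE2 (U1a), sub-row Δ1 «NE2⁰-Dirichlet» — THE TENT-vs-FACE COMPARISON, file 2 of 2:
# `n^d · ‖Q B − Λ•Φ(B)‖² ≤ 4 · Σ_μ ‖igrad_μ B‖²` for EVERY star-bond field `B` (any union of unit blocks, any `n ≥ 1`)

NE2 formalisation swarm `b2b-balaban-t4-ne2-formalise-*`, LEAF PROVER 06 (gen 5), supplier item «Δ1-VEC-W1-BOX-TENT» for the row NE2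
OWNER's O14-a «Δ1-VEC-W1-BOX» (`b2b-balaban-t4-ne2-p1` gen 14; file 1 `Support/RegionFaceFlux` p232334, journal 2026-08-20 l.19654 «BOOKED
OPEN … the TENT-vs-FACE comparison, for EVERY star-bond field B (no hypothesis, any union of blocks, any n ≥ 1 or 2):
`(n:ℝ)^d · nsq (fun i => (avgR n M S *ᵥ B) i − (tentW n M S i : ℂ) * (faceAvg n M S *ᵥ B) i) ≤ C♭ · Σ_μ nsq (igrad M S n μ B)` with an
absolute C♭»).  THIS FILE PROVES IT WITH **`C♭ = 4`** (**`tent_face_comparison`**), using ONLY the `ν`-differences of `ν`-components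
(**`tent_face_comparison_diag`**: the right-hand side `4·Σ_{b star} ‖igrad_{dir b} B b‖²`).

THE MECHANISM (the owner's, l.19654; ours — no printed statement is used).  For a unit bond `(y,ν)` read Bałaban's line average
([Balaban1984PropagatorsI] (1.18), tree `B5Block118.QvOp_mulVec`) in the digit chart `x = n·y + j` ([B5] (1.6)): with `colW j r` the
zero-extended field on the bond at height `r` of the `ν`-COLUMN of the double block `B(y) ∪ B(y+e_ν)` through the transverse offset `j`
(`j_ν = 0`), **`avgR_apply_eq`** `n^{d+1}·(QB)(y,ν) = Σ_{j : j_ν = 0} Σ_{s,t<n} colW j (s+t)` (the `ν`-fibring `Σ_j = Σ_s Σ_{j_ν = 0}` of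
`DirichletBoxTrace.sum_update_layers'`) and **`faceAvg_apply_eq`** `Φ(B)(y,ν) = n^{1−d}·Σ_{j : j_ν = 0} colW j (n−1)`; the bond at height
`r ≤ 2n−2` is a star bond iff `RegionTentColumn.starH [y ∈ S] [y+e_ν ∈ S] n r` (**`star_col_iff`**), `tentW (y,ν) = RegionTentColumn.lam`,
and the star-restricted column difference IS the interior difference: `dstep … r = ‖igrad_ν B‖` at height `r` (**`dstep_col_eq`**).  File 1's
`column_bound` then gives **`pointwise_bound`** `‖n^{d+2}·X(y,ν)‖ ≤ n²·Σ_{j,r<2n−2} ‖igrad_ν B (col_j r)‖`, Cauchy–Schwarz over the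
`n^{d−1}·(2n−2) ≤ 2n^d` column entries gives **`pointwise_sq_bound`** `n^d·‖X(y,ν)‖² ≤ 2·Σ_{j,r} ‖igrad_ν B (col_j r)‖²`, and every star bond
lies in the columns of at most TWO unit bonds (`y = blockOf z` and `blockOf z − e_ν`; **`sum_cols_le`**), whence `C♭ = 2·2 = 4`.

HONEST FRAMING (T4-DAG p. 1).  [folklore] finite lattice calculus on the cell's typed `U = 1` objects (`QvOp`, `bpt`, `digits`, `starReg`,
`avgR`, `faceAvg`, `tentW`, `igrad`); model level (one region = any union of unit blocks, one averaging scale, finite torus); an elementary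
inequality, NOT W1: the box slice inequality `sliceCoercive_box` is the OWNER's files 2–3; nothing printed is a hypothesis or a conclusion;
NE2 (U1a) NOT proved; spine PROVED 0/9 unchanged; NOT [B9] (3.16)/(3.23)–(3.27) as printed; NOT infinite volume / mass gap / Clay.
HONEST DEPENDENCY: continuum YM on T⁴ ⇐ BetaPertH ∧ nine spine estimates (0/9 proved); BetaPertH ⇐ (D1) ∧ (D4) ∧ CAP+tail; G-an2-4 gates
asym, D1 and NE2/3/4.  No `sorry`; data defs `colPt`, `colW`, `F0`, `dI` only; no `def … : Prop`.
-/

noncomputable section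

open scoped BigOperators ComplexConjugate Matrix
open Finset

namespace Summit.QuantumFields.BalabanUV.T4Continuum.RegionTentFaceComparison

open Literature.MathematicalPhysics.QuantumFieldTheory.Balaban1983to89.B5Prop11Plancherel (Tor fine unitVec)
open Literature.MathematicalPhysics.QuantumFieldTheory.Balaban1983to89.B5Prop11Lower (nsq nsq_nonneg)
open Literature.MathematicalPhysics.QuantumFieldTheory.Balaban1983to89.B5Block118 (bpt QvOp QvOp_mulVec lineSum tstep tstep_succ bpt_add_tstep)
open Literature.MathematicalPhysics.QuantumFieldTheory.Balaban1983to89.B5Blocks16 (blockOf blockOf_bpt)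
open Summit.QuantumFields.BalabanUV.T4Continuum
open Summit.QuantumFields.BalabanUV.T4Continuum.SubtypeCompression (ext ext_apply_of ext_apply_of_not)
open Summit.QuantumFields.BalabanUV.T4Continuum.RegionGaugeFixedVector (starReg avgR)
open Summit.QuantumFields.BalabanUV.T4Continuum.RegionGaugeFixedVectorFlat (avgR_mulVec)
open Summit.QuantumFields.BalabanUV.T4Continuum.RegionStarLineGauge (edig edig_bpt lastD tstep_add)
open Summit.QuantumFields.BalabanUV.T4Continuum.RegionFaceFlux (faceW faceAvg lamB tentW)
open Summit.QuantumFields.BalabanUV.T4Continuum.DirichletStarRenormTower (igrad)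
open Summit.QuantumFields.BalabanUV.T4Continuum.DirichletStarClassPoincare (igrad_eq_of_succ)
open Summit.QuantumFields.BalabanUV.T4Continuum.RegionTentColumn (starH lam dstep dstep_nonneg column_bound colPt F0 mem_F0 colPt_succ
  colPt_add colPt_eq_bpt_update star_col_iff)
open Summit.QuantumFields.BalabanUV.Beta.GAN24.DirichletBoxTrace (blockReg sum_eq_sum_bpt sum_update_layers' bpt_update_add_tstep)

variable {d : ℕ} (n : ℕ) [NeZero n] (M : Fin d → ℕ) [hM : ∀ μ, NeZero (M μ)]

section Region

variable (S : Tor M → Prop) [DecidablePred S]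

/-! ## §2 The dictionary: `Q B` and `Φ(B)` along the columns, the tent weight, the interior differences -/

/-- the COLUMN FIELD: the zero-extended star-bond field on the `ν`-bond at height `r` of the column `j` over `(y,ν)`. [folklore] -/
def colW (B : {b // starReg n M S b} → ℂ) (y : Tor M) (ν : Fin d) (j : Fin d → Fin n) (r : ℕ) : ℂ :=
  ext (starReg n M S) B (colPt n M y ν j r, ν)

/-- **BAŁABAN's LINE AVERAGE ALONG THE COLUMNS**: `n^{d+1}·(Q B)(y,ν) = Σ_{j : j_ν = 0} Σ_{s<n} Σ_{t<n} colW j (s + t)` (base point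
`n·y + j[ν ↦ s]`, `t`-th bond of the straight contour). [cite: Balaban1984PropagatorsI, (1.18) p.20 (shape)] [folklore] -/
theorem avgR_apply_eq (B : {b // starReg n M S b} → ℂ) (y : Tor M) (ν : Fin d) :
    (n : ℂ) ^ (d + 1) * (avgR n M S *ᵥ B) (y, ν)
      = ∑ j ∈ F0 n ν, ∑ s ∈ range n, ∑ t ∈ range n, colW n M S B y ν j (s + t) := by
  have hn : (n : ℂ) ^ (d + 1) ≠ 0 := pow_ne_zero _ (Nat.cast_ne_zero.mpr (NeZero.ne n))
  rw [avgR_mulVec, QvOp_mulVec, ← mul_assoc, mul_one_div_cancel hn, one_mul]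
  simp only [lineSum]
  rw [sum_update_layers' n ν, sum_comm]
  refine sum_congr rfl fun j hj => ?_
  have hj0 : (j ν : ℕ) = 0 := (mem_F0 n).mp hj
  rw [← Fin.sum_univ_eq_sum_range (fun s => ∑ t ∈ range n, colW n M S B y ν j (s + t)) n]
  refine sum_congr rfl fun s _ => ?_
  rw [← Fin.sum_univ_eq_sum_range (fun t => colW n M S B y ν j (s + t)) n]
  refine sum_congr rfl fun t _ => ?_
  rw [← colPt_eq_bpt_update n M y hj0 s]
  unfold colW colPt
  rw [add_assoc, ← tstep_add]

/-- **THE FACE FLUX ALONG THE COLUMNS**: `Φ(B)(y,ν) = n^{1−d}·Σ_{j : j_ν = 0} colW j (n − 1)` (the top `ν`-face of `B(y)` is height `n−1`). [folklore] -/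
theorem faceAvg_apply_eq (B : {b // starReg n M S b} → ℂ) (y : Tor M) (ν : Fin d) :
    (faceAvg n M S *ᵥ B) (y, ν) = faceW d n * ∑ j ∈ F0 n ν, colW n M S B y ν j (n - 1) := by
  set Z := ext (starReg n M S) B with hZ
  -- the summand read on ALL bonds
  set g : Tor (fine n M) × Fin d → ℂ := fun bb =>
    (if bb.2 = ν ∧ blockOf n M bb.1 = y ∧ edig n M ν bb.1 + 1 = n then faceW d n else 0) * Z bb with hg
  have e1 : (faceAvg n M S *ᵥ B) (y, ν) = ∑ bb, g bb := by
    simp only [Matrix.mulVec, dotProduct]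
    rw [← Fintype.sum_subtype_add_sum_subtype (starReg n M S) g]
    have h0 : ∑ b : {x // ¬ starReg n M S x}, g b = 0 :=
      sum_eq_zero fun b _ => by rw [hg]; dsimp only; rw [hZ, ext_apply_of_not _ _ b.2, mul_zero]
    rw [h0, add_zero]
    refine sum_congr rfl fun b _ => ?_
    rw [hg]; dsimp only
    rw [hZ, ext_apply_of _ _ b]
    rfl
  -- only the direction `ν` contributes
  have e2 : ∑ bb, g bb = ∑ z : Tor (fine n M), (if blockOf n M z = y ∧ edig n M ν z + 1 = n then faceW d n else 0) * Z (z, ν) := by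
    rw [Fintype.sum_prod_type]
    refine sum_congr rfl fun z _ => ?_
    rw [Finset.sum_eq_single ν]
    · rw [hg]; dsimp only; simp only [true_and]
    · intro μ _ hne; rw [hg]; dsimp only; rw [if_neg (fun h => hne h.1), zero_mul]
    · intro h; exact absurd (mem_univ ν) h
  -- the digit chart: only the block `y` and the digit `n − 1` contribute
  have e3 : ∑ z : Tor (fine n M), (if blockOf n M z = y ∧ edig n M ν z + 1 = n then faceW d n else 0) * Z (z, ν)
      = ∑ j : Fin d → Fin n, (if (j ν : ℕ) + 1 = n then faceW d n else 0) * Z (bpt n M y j, ν) := by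
    rw [sum_eq_sum_bpt n M, Finset.sum_eq_single y]
    · refine sum_congr rfl fun j _ => ?_
      rw [blockOf_bpt, edig_bpt]; simp only [true_and]
    · intro y' _ hne
      exact sum_eq_zero fun j _ => by rw [blockOf_bpt, if_neg (fun h => hne h.1), zero_mul]
    · intro h; exact absurd (mem_univ y) h
  -- the `ν`-fibring: only the layer `s = n − 1` contributes
  have e4 : ∑ j : Fin d → Fin n, (if (j ν : ℕ) + 1 = n then faceW d n else 0) * Z (bpt n M y j, ν)
      = faceW d n * ∑ j ∈ F0 n ν, colW n M S B y ν j (n - 1) := by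
    rw [sum_update_layers' n ν, Finset.sum_eq_single (lastD n)]
    · rw [mul_sum]
      refine sum_congr rfl fun j hj => ?_
      have hj0 : (j ν : ℕ) = 0 := (mem_F0 n).mp hj
      have hl : ((lastD n : Fin n) : ℕ) = n - 1 := rfl
      rw [Function.update_self, if_pos (by rw [hl]; have := Nat.pos_of_ne_zero (NeZero.ne n); omega)]
      unfold colW
      rw [← hl, colPt_eq_bpt_update n M y hj0]
    · intro s _ hne
      refine sum_eq_zero fun j _ => ?_
      rw [Function.update_self, if_neg, zero_mul]
      intro h
      apply hne
      exact Fin.ext (by show (s : ℕ) = n - 1; omega)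
    · intro h; exact absurd (mem_univ _) h
  rw [e1, e2, e3, e4]

omit [NeZero n] hM in
/-- the tent weight of the bond `(y,ν)` is file 1's `lam [y ∈ S] [y + e_ν ∈ S] n`. [folklore] -/
theorem tentW_eq_lam (y : Tor M) (ν : Fin d) : tentW n M S (y, ν) = lam (S y) (S (y + unitVec M ν)) n := by
  simp only [tentW, lam, lamB]

/-- off the star heights the column field vanishes. [folklore] -/
theorem colW_eq_zero (B : {b // starReg n M S b} → ℂ) (y : Tor M) {ν : Fin d} {j : Fin d → Fin n} (hj : (j ν : ℕ) = 0)
    {r : ℕ} (hr : r + 1 < 2 * n) (h : ¬ starH (S y) (S (y + unitVec M ν)) n r) : colW n M S B y ν j r = 0 := by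
  unfold colW
  exact ext_apply_of_not _ _ (fun hs => h ((star_col_iff n M S y hj hr).mp hs))

/-- THE INTERIOR DIFFERENCE OF A STAR-BOND FIELD IN ITS OWN DIRECTION, read on all bonds (`0` off the star bonds):
`dI B (z,ν) = ‖igrad_ν B (z,ν)‖`. [folklore] -/
def dI (B : {b // starReg n M S b} → ℂ) (bb : Tor (fine n M) × Fin d) : ℝ :=
  if h : starReg n M S bb then ‖igrad M S n bb.2 B ⟨bb, h⟩‖ else 0

/-- `0 ≤ dI`. [folklore] -/
theorem dI_nonneg (B : {b // starReg n M S b} → ℂ) (bb : Tor (fine n M) × Fin d) : 0 ≤ dI n M S B bb := by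
  unfold dI; split_ifs <;> positivity

/-- **THE STAR-RESTRICTED COLUMN DIFFERENCE IS THE INTERIOR DIFFERENCE**: `dstep … (colW j) r = dI B (colPt j r, ν)` for `r ≤ 2n − 3`. [folklore] -/
theorem dstep_col_eq (B : {b // starReg n M S b} → ℂ) (y : Tor M) {ν : Fin d} {j : Fin d → Fin n} (hj : (j ν : ℕ) = 0)
    {r : ℕ} (hr : r + 2 < 2 * n) :
    dstep (S y) (S (y + unitVec M ν)) n (colW n M S B y ν j) r = dI n M S B (colPt n M y ν j r, ν) := by
  have hr1 : r + 1 < 2 * n := by omega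
  have hr2 : r + 1 + 1 < 2 * n := by omega
  have i1 := star_col_iff n M S y hj hr1
  have i2 := star_col_iff n M S y hj hr2
  unfold dstep dI
  by_cases h1 : starReg n M S (colPt n M y ν j r, ν)
  · by_cases h2 : starReg n M S (colPt n M y ν j (r + 1), ν)
    · rw [if_pos ⟨i1.mp h1, i2.mp h2⟩, dif_pos h1,
        igrad_eq_of_succ M S n ν B ⟨_, h1⟩ ⟨_, h2⟩ (by simp only [colPt_succ])]
      unfold colW
      rw [ext_apply_of _ _ ⟨_, h1⟩, ext_apply_of _ _ ⟨_, h2⟩]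
    · rw [if_neg (fun h => h2 (i2.mpr h.2)), dif_pos h1]
      unfold igrad
      rw [dif_neg (by rw [← colPt_succ]; exact h2), norm_zero]
  · rw [if_neg (fun h => h1 (i1.mpr h.1)), dif_neg h1]

/-! ## §3 The pointwise bound at one unit bond -/

/-- the TENT RESIDUAL `X = Q B − Λ•Φ(B)` on the unit bonds. [folklore] -/
def tentRes (B : {b // starReg n M S b} → ℂ) : Tor M × Fin d → ℂ := fun i =>
  (avgR n M S *ᵥ B) i - ((tentW n M S i : ℝ) : ℂ) * (faceAvg n M S *ᵥ B) i

/-- **THE POINTWISE BOUND**: `‖n^{d+2}·X(y,ν)‖ ≤ n²·Σ_{j : j_ν = 0} Σ_{r < 2n−2} dI B (colPt j r, ν)`. [folklore] -/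
theorem pointwise_bound (B : {b // starReg n M S b} → ℂ) (y : Tor M) (ν : Fin d) :
    ‖(n : ℂ) ^ (d + 2) * tentRes n M S B (y, ν)‖
      ≤ (n : ℝ) ^ 2 * ∑ j ∈ F0 n ν, ∑ r ∈ range (2 * n - 2), dI n M S B (colPt n M y ν j r, ν) := by
  have hn0 : (n : ℂ) ≠ 0 := Nat.cast_ne_zero.mpr (NeZero.ne n)
  have hnpos : 0 < n := Nat.pos_of_ne_zero (NeZero.ne n)
  -- `n^{d+1}·faceW = n²`
  have hfw : (n : ℂ) ^ (d + 1) * faceW d n = (n : ℂ) ^ 2 := by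
    unfold faceW; rw [pow_succ]; field_simp
  -- the two pieces along the columns
  have hA := avgR_apply_eq n M S B y ν
  have hF : (n : ℂ) ^ (d + 1) * ((((tentW n M S (y, ν) : ℝ)) : ℂ) * (faceAvg n M S *ᵥ B) (y, ν))
      = ∑ j ∈ F0 n ν, ((lam (S y) (S (y + unitVec M ν)) n * (n : ℝ) ^ 2 : ℝ) : ℂ) * colW n M S B y ν j (n - 1) := by
    rw [tentW_eq_lam, faceAvg_apply_eq, mul_sum, mul_sum, mul_sum]
    refine sum_congr rfl fun j _ => ?_
    push_cast
    rw [← hfw]; ring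
  -- distribute over the columns
  have e1 : (n : ℂ) ^ (d + 2) * tentRes n M S B (y, ν)
      = ∑ j ∈ F0 n ν, (n : ℂ) * (∑ s ∈ range n, ∑ t ∈ range n, colW n M S B y ν j (s + t)
          - ((lam (S y) (S (y + unitVec M ν)) n * (n : ℝ) ^ 2 : ℝ) : ℂ) * colW n M S B y ν j (n - 1)) := by
    unfold tentRes
    rw [pow_succ, mul_comm ((n : ℂ) ^ (d + 1)) (n : ℂ), mul_assoc, mul_sub ((n : ℂ) ^ (d + 1)), hA, hF,
      ← sum_sub_distrib, mul_sum]
  rw [e1]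
  refine (norm_sum_le _ _).trans ?_
  rw [mul_sum]
  refine sum_le_sum fun j hj => ?_
  have hj0 : (j ν : ℕ) = 0 := (mem_F0 n).mp hj
  refine (column_bound (S y) (S (y + unitVec M ν)) n (colW n M S B y ν j) hnpos
    (fun r hr h => colW_eq_zero n M S B y hj0 hr h)).trans ?_
  refine mul_le_mul_of_nonneg_left (le_of_eq (sum_congr rfl fun r hr => ?_)) (by positivity)
  rw [mem_range] at hr
  exact dstep_col_eq n M S B y hj0 (by omega)

omit hM in
/-- the number of transverse offsets: `|F0|·n = n^d`. [folklore] -/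
theorem card_F0_mul (ν : Fin d) : ((F0 n ν).card : ℝ) * n = (n : ℝ) ^ d := by
  have h : ∑ _j : Fin d → Fin n, (1 : ℝ) = ∑ _s : Fin n, ∑ _j ∈ F0 n ν, (1 : ℝ) := by
    rw [sum_update_layers' n ν (fun _ => (1 : ℝ))]; rfl
  rw [sum_const, sum_const, sum_const, card_univ, card_univ, Fintype.card_fin, smul_smul, nsmul_eq_mul, nsmul_eq_mul, mul_one,
    mul_one, Fintype.card_fun, Fintype.card_fin, Fintype.card_fin] at h
  push_cast at h
  rw [h]; ring

/-- **THE SQUARED POINTWISE BOUND** (Cauchy–Schwarz over the `|F0|·(2n−2) ≤ 2n^d` column entries):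
`n^d·‖X(y,ν)‖² ≤ 2·Σ_{j : j_ν = 0} Σ_{r < 2n−2} dI B (colPt j r, ν)²`. [folklore] -/
theorem pointwise_sq_bound (B : {b // starReg n M S b} → ℂ) (y : Tor M) (ν : Fin d) :
    (n : ℝ) ^ d * ‖tentRes n M S B (y, ν)‖ ^ 2
      ≤ 2 * ∑ j ∈ F0 n ν, ∑ r ∈ range (2 * n - 2), dI n M S B (colPt n M y ν j r, ν) ^ 2 := by
  have hn : (0 : ℝ) < n := by exact_mod_cast Nat.pos_of_ne_zero (NeZero.ne n)
  set T := ∑ j ∈ F0 n ν, ∑ r ∈ range (2 * n - 2), dI n M S B (colPt n M y ν j r, ν) with hT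
  set T2 := ∑ j ∈ F0 n ν, ∑ r ∈ range (2 * n - 2), dI n M S B (colPt n M y ν j r, ν) ^ 2 with hT2
  have h1 := pointwise_bound n M S B y ν
  rw [norm_mul, norm_pow, Complex.norm_natCast] at h1
  -- square
  have h2 : ((n : ℝ) ^ (d + 2) * ‖tentRes n M S B (y, ν)‖) ^ 2 ≤ ((n : ℝ) ^ 2 * T) ^ 2 := by gcongr
  -- Cauchy–Schwarz twice
  have hcs : T ^ 2 ≤ (F0 n ν).card * ((2 * n - 2 : ℕ) * T2) := by
    calc T ^ 2 ≤ (F0 n ν).card * ∑ j ∈ F0 n ν, (∑ r ∈ range (2 * n - 2), dI n M S B (colPt n M y ν j r, ν)) ^ 2 :=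
          sq_sum_le_card_mul_sum_sq
      _ ≤ (F0 n ν).card * ∑ j ∈ F0 n ν, ((range (2 * n - 2)).card * ∑ r ∈ range (2 * n - 2), dI n M S B (colPt n M y ν j r, ν) ^ 2) := by
          gcongr with j hj
          exact sq_sum_le_card_mul_sum_sq
      _ = (F0 n ν).card * ((2 * n - 2 : ℕ) * T2) := by rw [card_range, ← mul_sum]
  have hcard : ((F0 n ν).card : ℝ) * ((2 * n - 2 : ℕ) : ℝ) ≤ 2 * (n : ℝ) ^ d := by
    rw [← card_F0_mul n ν]
    have : ((2 * n - 2 : ℕ) : ℝ) ≤ 2 * n := by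
      have h' : 2 * n - 2 ≤ 2 * n := Nat.sub_le _ _
      exact_mod_cast h'
    nlinarith [Nat.cast_nonneg (α := ℝ) (F0 n ν).card]
  have hT2nn : 0 ≤ T2 := sum_nonneg fun j _ => sum_nonneg fun r _ => by positivity
  -- assemble: n^{2d+4}‖X‖² ≤ n^4·T² ≤ n^4·2n^d·T2, divide by n^{d+4}
  have h3 : (n : ℝ) ^ (d + 4) * ((n : ℝ) ^ d * ‖tentRes n M S B (y, ν)‖ ^ 2) ≤ (n : ℝ) ^ (d + 4) * (2 * T2) := by
    calc (n : ℝ) ^ (d + 4) * ((n : ℝ) ^ d * ‖tentRes n M S B (y, ν)‖ ^ 2) = ((n : ℝ) ^ (d + 2) * ‖tentRes n M S B (y, ν)‖) ^ 2 := by ring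
      _ ≤ ((n : ℝ) ^ 2 * T) ^ 2 := h2
      _ = (n : ℝ) ^ 4 * T ^ 2 := by ring
      _ ≤ (n : ℝ) ^ 4 * ((F0 n ν).card * ((2 * n - 2 : ℕ) * T2)) := by gcongr
      _ = (n : ℝ) ^ 4 * (((F0 n ν).card * (2 * n - 2 : ℕ)) * T2) := by ring
      _ ≤ (n : ℝ) ^ 4 * ((2 * (n : ℝ) ^ d) * T2) := by gcongr
      _ = (n : ℝ) ^ (d + 4) * (2 * T2) := by ring
  exact le_of_mul_le_mul_left h3 (by positivity)

/-! ## §4 Summation over the unit bonds: every star bond lies in the columns of at most two unit bonds -/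

/-- the columns of the unit bonds `(y,ν)`, `y ∈ T₁`, at heights `< 2n − 2` cover every fine site at most twice:
`Σ_y Σ_{j : j_ν = 0} Σ_{r < 2n−2} g(colPt y ν j r) ≤ 2·Σ_z g(z)` for `g ≥ 0`. [folklore] -/
theorem sum_cols_le (ν : Fin d) (g : Tor (fine n M) → ℝ) (hg : ∀ z, 0 ≤ g z) :
    ∑ y : Tor M, ∑ j ∈ F0 n ν, ∑ r ∈ range (2 * n - 2), g (colPt n M y ν j r) ≤ 2 * ∑ z, g z := by
  -- one block of columns = the block
  have hblock : ∀ y : Tor M, ∑ j ∈ F0 n ν, ∑ r ∈ range n, g (colPt n M y ν j r) = ∑ j : Fin d → Fin n, g (bpt n M y j) := by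
    intro y
    conv_rhs => rw [sum_update_layers' n ν (fun j => g (bpt n M y j)), sum_comm]
    refine sum_congr rfl fun j hj => ?_
    have hj0 : (j ν : ℕ) = 0 := (mem_F0 n).mp hj
    rw [← Fin.sum_univ_eq_sum_range (fun r => g (colPt n M y ν j r)) n]
    exact sum_congr rfl fun s _ => by rw [colPt_eq_bpt_update n M y hj0 s]
  calc ∑ y : Tor M, ∑ j ∈ F0 n ν, ∑ r ∈ range (2 * n - 2), g (colPt n M y ν j r)
      ≤ ∑ y : Tor M, ∑ j ∈ F0 n ν, ∑ r ∈ range (n + n), g (colPt n M y ν j r) := by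
        refine sum_le_sum fun y _ => sum_le_sum fun j _ => sum_le_sum_of_subset_of_nonneg (range_mono (by omega)) ?_
        intro r _ _; exact hg _
    _ = ∑ y : Tor M, ∑ j : Fin d → Fin n, g (bpt n M y j) + ∑ y : Tor M, ∑ j : Fin d → Fin n, g (bpt n M (y + unitVec M ν) j) := by
        rw [← sum_add_distrib]
        refine sum_congr rfl fun y _ => ?_
        rw [← hblock y, ← hblock (y + unitVec M ν), ← sum_add_distrib]
        refine sum_congr rfl fun j _ => ?_
        rw [sum_range_add]
        simp only [colPt_add]
    _ = ∑ z, g z + ∑ z, g z := by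
        rw [← sum_eq_sum_bpt n M g]
        congr 1
        rw [show (∑ y : Tor M, ∑ j : Fin d → Fin n, g (bpt n M (y + unitVec M ν) j))
            = ∑ y : Tor M, ∑ j : Fin d → Fin n, g (bpt n M y j) from
            Fintype.sum_equiv (Equiv.addRight (unitVec M ν)) _ _ (fun y => rfl), ← sum_eq_sum_bpt n M g]
    _ = 2 * ∑ z, g z := by ring

/-- the interior differences in their own direction are part of all interior differences:
`Σ_{bb} dI B bb² ≤ Σ_μ nsq (igrad_μ B)`. [folklore] -/
theorem sum_dI_sq_le (B : {b // starReg n M S b} → ℂ) :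
    ∑ bb : Tor (fine n M) × Fin d, dI n M S B bb ^ 2 ≤ ∑ μ, nsq (igrad M S n μ B) := by
  rw [← Fintype.sum_subtype_add_sum_subtype (starReg n M S) (fun bb => dI n M S B bb ^ 2)]
  have h0 : ∑ b : {x // ¬ starReg n M S x}, dI n M S B b ^ 2 = 0 :=
    sum_eq_zero fun b _ => by unfold dI; rw [dif_neg b.2]; ring
  rw [h0, add_zero]
  have h1 : ∀ b : {x // starReg n M S x}, dI n M S B b ^ 2 = ‖igrad M S n b.1.2 B b‖ ^ 2 := fun b => by
    unfold dI; rw [dif_pos b.2]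
  simp_rw [h1]
  unfold nsq
  rw [sum_comm]
  exact sum_le_sum fun b _ => single_le_sum (f := fun μ => ‖igrad M S n μ B b‖ ^ 2) (fun μ _ => by positivity) (mem_univ _)

/-! ## §5 The ENDs -/

/-- **THE TENT-vs-FACE COMPARISON, DIAGONAL FORM**: `n^d·‖Q B − Λ•Φ(B)‖² ≤ 4·Σ_{bb} dI B bb²` — only the `ν`-differences of the
`ν`-components enter. [folklore] -/
theorem tent_face_comparison_diag (B : {b // starReg n M S b} → ℂ) :
    (n : ℝ) ^ d * nsq (fun i : Tor M × Fin d => (avgR n M S *ᵥ B) i - ((tentW n M S i : ℝ) : ℂ) * (faceAvg n M S *ᵥ B) i)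
      ≤ 4 * ∑ bb : Tor (fine n M) × Fin d, dI n M S B bb ^ 2 := by
  show (n : ℝ) ^ d * nsq (tentRes n M S B) ≤ _
  unfold nsq
  rw [Fintype.sum_prod_type, Fintype.sum_prod_type, mul_sum]
  rw [show (∑ z : Tor (fine n M), ∑ μ : Fin d, dI n M S B (z, μ) ^ 2) = ∑ μ : Fin d, ∑ z : Tor (fine n M), dI n M S B (z, μ) ^ 2
    from sum_comm]
  rw [show (∑ y : Tor M, (n : ℝ) ^ d * ∑ ν : Fin d, ‖tentRes n M S B (y, ν)‖ ^ 2) = ∑ ν : Fin d, ∑ y : Tor M, (n : ℝ) ^ d * ‖tentRes n M S B (y, ν)‖ ^ 2 by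
    rw [sum_comm]; exact sum_congr rfl fun y _ => mul_sum _ _ _]
  rw [mul_sum]
  refine sum_le_sum fun ν _ => ?_
  calc ∑ y : Tor M, (n : ℝ) ^ d * ‖tentRes n M S B (y, ν)‖ ^ 2
      ≤ ∑ y : Tor M, 2 * ∑ j ∈ F0 n ν, ∑ r ∈ range (2 * n - 2), dI n M S B (colPt n M y ν j r, ν) ^ 2 :=
        sum_le_sum fun y _ => pointwise_sq_bound n M S B y ν
    _ = 2 * ∑ y : Tor M, ∑ j ∈ F0 n ν, ∑ r ∈ range (2 * n - 2), dI n M S B (colPt n M y ν j r, ν) ^ 2 := by rw [mul_sum]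
    _ ≤ 2 * (2 * ∑ z : Tor (fine n M), dI n M S B (z, ν) ^ 2) := by
        gcongr
        exact sum_cols_le n M ν (fun z => dI n M S B (z, ν) ^ 2) fun z => by positivity
    _ = 4 * ∑ z : Tor (fine n M), dI n M S B (z, ν) ^ 2 := by ring

/-- **THE TENT-vs-FACE COMPARISON** (the owner's booked shape «Δ1-VEC-W1-BOX-TENT» with `C♭ = 4`): for EVERY star-bond field `B`
on any union of unit blocks and every `n ≥ 1`,
`(n:ℝ)^d · nsq (fun i => (avgR n M S *ᵥ B) i − (tentW n M S i : ℂ) * (faceAvg n M S *ᵥ B) i) ≤ 4 · Σ_μ nsq (igrad M S n μ B)`. [folklore] -/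
theorem tent_face_comparison (B : {b // starReg n M S b} → ℂ) :
    (n : ℝ) ^ d * nsq (fun i : Tor M × Fin d => (avgR n M S *ᵥ B) i - ((tentW n M S i : ℝ) : ℂ) * (faceAvg n M S *ᵥ B) i)
      ≤ 4 * ∑ μ, nsq (igrad M S n μ B) :=
  (tent_face_comparison_diag n M S B).trans (by have := sum_dI_sq_le n M S B; linarith)

end Region

end Summit.QuantumFields.BalabanUV.T4Continuum.RegionTentFaceComparison

end
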